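import Summits.QuantumFields.YangMills.Theorems.IR.ShellMaxCorrCofinalEngine
import Summits.QuantumFields.YangMills.Theorems.IR.ShellMaxCorrRung

/-!
# Crux `IR` (item stmt-QuantumFields-19354) — merged line «maximal correlation at one physical thickness»:
RUNG ∘ ENGINE — volume-uniform exponential clustering at STRONG coupling, in lattice units, for every compact gauge group

Helper module for item `stmt-QuantumFields-19354` (`--supports … --as helper`; it closes nothing; lead prover
ym-ir-line-mxc-p1 g5).  The line's two landed halves compose END TO END at strong coupling: the BC5 rung
`ShellMaxCorr.stub_shellRung : ShellRung` (p596102 — maximal correlation `≤ ½` across ONE link layer for `|β| ≤ β₀(ρ)`, every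
radius, every odd torus; Dobrushin ⇒ dimension-free heat-bath Poincaré + one-link boundary tilts) is a shell certificate with
`K₀ = 1`, `θ = ½` in LATTICE units (`ab = 1`), and the per-coupling kernel of the engine
`ShellMaxCorr.abs_latticeConnectedCorr_le_exp_of_shellCert` (p618715 — doubling law `Ψ(2s+1) ≤ Ψ(s)²` from the Markov layer +
Hilbert product, iterated) turns it into

  `strongCoupling_clustering`: for every compact metrisable `G`, every continuous unitary-matrix representation `ρ`, there is
  `β₀ > 0` such that for all `|β| ≤ β₀`, all odd tori `(2S+1)⁴` and every pair of local gauge-invariant observables `A, B`,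
  `|⟨A · τ_n B⟩_β − ⟨A⟩_β⟨B⟩_β| ≤ C(A,B) · e^{−(log 2 / 6) · n}` for all `n ≤ S` — ONE constant per pair, uniform in `β` and
  in the volume, rate `log 2 / 6` per lattice unit.

This is the clustering clause of Osterwalder–Seiler's strong-coupling theorem (Ann. Phys. 110 (1978) Thm 3.5; in the tree, in
infinite volume and by the cluster expansion, `Literature.MathematicalPhysics.QuantumFieldTheory.osterwalderSeiler_clustering_holds`)
re-proved on tori by a DIFFERENT route (no cluster expansion: Dobrushin uniqueness technology + the Markov property of the
plaquette action + Hilbert-space doubling), with a worse rate but constants uniform in the volume from the start.  For the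
line it is the BC5 FORMAT VALIDATION the critics asked for (crit-1 (4b), crit-2 P3): the typed pipeline «certificate ⇒
`GapInUnits`-type clustering» is non-vacuous and produces a genuine theorem where a certificate is available (small `β`); at
weak coupling the certificate (`IRShellCorr` / `IRShellCorrCof`) remains the open XL load.

HONEST FRAMING: a STRONG-coupling statement in LATTICE units (rate does not scale with any physical unit `a(β)`); it says nothing
about weak coupling, the continuum limit, `BalabanLadder.IR`/`IRcof`, or the Clay Yang–Mills mass gap; R4 closes only the
finite-𝕋⁴ UV rung `BalabanLadder.UV`.

Refs: K. Osterwalder, E. Seiler, Ann. Phys. 110 (1978) 440–471, Thm 3.5; R. L. Dobrushin, Theory Probab. Appl. 13 (1968);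
Bradley, Probab. Surveys 2 (2005) §1.
-/

set_option autoImplicit false

noncomputable section

open Filter Topology MeasureTheory ProbabilityTheory
open Literature.MathematicalPhysics.QuantumFieldTheory Literature.MathematicalPhysics.QuantumLattice

namespace Summit.QuantumFields.YangMills.Cruxes.IR.ShellMaxCorr

section StrongCoupling

variable {G : Type} [Group G] [TopologicalSpace G] [IsTopologicalGroup G] [CompactSpace G]
  [T2Space G] [SecondCountableTopology G] [MeasurableSpace G] [BorelSpace G]

/-- **Rung ∘ engine, hypotheses form.**  A one-layer shell certificate `Ψ_β(1) ≤ ½` on an interval of couplings `|β| ≤ β₀`,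
uniform in the radius and the torus (`ShellRung`), gives volume-uniform exponential clustering of every pair of local
gauge-invariant observables at rate `log 2 / 6` per lattice unit, with ONE constant per pair for all `|β| ≤ β₀` and all odd
tori: the per-coupling kernel `abs_latticeConnectedCorr_le_exp_of_shellCert` at `K₀ = ab = 1`, `θ₁ = ½`. -/
theorem strongCoupling_clustering_of_shellRung (hR : ShellRung) {m : ℕ} (ρ : G →* Matrix (Fin m) (Fin m) ℂ)
    (hρ : Continuous ρ) :
    ∃ β₀ : ℝ, 0 < β₀ ∧ ∀ A B : LocalGaugeObservable 4 G, ∃ C : ℝ, ∀ β : ℝ, |β| ≤ β₀ →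
      ∀ S n : ℕ, n ≤ S →
        |latticeConnectedCorr ρ β (2 * S + 1) A.F B.F n| ≤ C * Real.exp (-(Real.log 2 / 6 * n)) := by
  obtain ⟨β₀, hβ₀, h⟩ := hR G m ρ hρ
  refine ⟨β₀, hβ₀, fun A B => ?_⟩
  obtain ⟨rA, hA⟩ := exists_radius_dependsOn_inBall A
  obtain ⟨rB, hB⟩ := exists_radius_dependsOn_outBall B
  obtain ⟨CA, hCA⟩ := A.bounded
  obtain ⟨CB, hCB⟩ := B.bounded
  refine ⟨2 * CA * CB * Real.exp (Real.log 2 / 6 * ((rA : ℝ) + rB + 2)), fun β hβ S n hn => ?_⟩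
  -- the rung is a shell certificate at thickness `⌈1/1⌉ = 1` with `θ = ½`
  have hceil : ⌈(1 : ℝ) / 1⌉₊ = 1 := by norm_num
  have hcert : ShellCert ρ β S ⌈(1 : ℝ) / 1⌉₊ (1 / 2) := by
    rw [hceil]; exact fun R => h β hβ S R
  have key := abs_latticeConnectedCorr_le_exp_of_shellCert ρ hρ (K₀ := 1) (θ₁ := 1 / 2) (ab := 1) one_pos
    one_half_pos one_half_lt_one one_pos le_rfl β S hcert A B hA hB hCA hCB hn
  have hrate : -Real.log (1 / 2) / (6 * 1) * 1 = Real.log 2 / 6 := by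
    rw [one_div, Real.log_inv]; ring
  rw [hrate] at key
  exact key

/-- **Volume-uniform exponential clustering at strong coupling for every compact (metrisable) gauge group** — rung ∘ engine
of the line, unconditionally: for a continuous representation `ρ` there is `β₀ > 0` such that for all `|β| ≤ β₀`, all odd
tori and all local gauge-invariant `A, B`, `|⟨A τ_n B⟩ − ⟨A⟩⟨B⟩| ≤ C(A,B) e^{−(log 2/6) n}` (`n ≤ S`).  Osterwalder–Seiler
1978 Thm 3.5 (clustering clause), re-proved on tori via Dobrushin–Poincaré + Markov doubling (no cluster expansion). -/
theorem strongCoupling_clustering {m : ℕ} (ρ : G →* Matrix (Fin m) (Fin m) ℂ) (hρ : Continuous ρ) :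
    ∃ β₀ : ℝ, 0 < β₀ ∧ ∀ A B : LocalGaugeObservable 4 G, ∃ C : ℝ, ∀ β : ℝ, |β| ≤ β₀ →
      ∀ S n : ℕ, n ≤ S →
        |latticeConnectedCorr ρ β (2 * S + 1) A.F B.F n| ≤ C * Real.exp (-(Real.log 2 / 6 * n)) :=
  strongCoupling_clustering_of_shellRung stub_shellRung ρ hρ

end StrongCoupling

end Summit.QuantumFields.YangMills.Cruxes.IR.ShellMaxCorr

end
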